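import Literature.NumberTheory.EllipticCurves.MordellCurveSqrtThreeEndomorphism
import Literature.NumberTheory.EllipticCurves.IsogenyRangeIndex
import Literature.NumberTheory.EllipticCurves.QuadraticTwistRank
import Literature.NumberTheory.EllipticCurves.MordellWeilTheoremProofs
import HarnessLib

/-!
# The `√−3`-descent count `#δ(E'(K)) = 3^{rank E'(ℚ) + 1}` on `y² = x³ + b²` over `ℚ(√−3)`

Topic `NumberTheory/EllipticCurves`. Sequel of `MordellCurveSqrtThreeEndomorphism.lean` (the complex
multiplication `f = [√−3]` on the `K`-points of `E' : Y² = X³ + (9c)²`, `K ∋ θ = √−3`, with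
`f ∘ f = −3`, `#ker f = 3`, and `δ(P) = 1 ↔ P ∈ f(E'(K))` for the `φ`-descent map
`δ : (X, Y) ↦ [Y + 9c] ∈ K^×/K^{×3}`) and `IsogenyRangeIndex.lean`
(`[A : f(A)] = 3^{rank A/2 + 1}`): over a NUMBER field `K ∋ √−3` (Mordell–Weil, tree
`WeierstrassCurve.module_finite_point_holds`)

* `natCard_range_cubicDescentClass`: `#δ(E'(K)) = 3^{rank_ℤ E'(K)/2 + 1}`, `rank_ℤ E'(K)` even;
* `mordellWeilRank_eq_two_mul`: for `K` QUADRATIC over `ℚ` and `9c = b ∈ ℚ^×`,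
  `rank_ℤ E'(K) = 2 rank_ℤ E'_b(ℚ)` (`rank E(K) = rank E(ℚ) + rank E^{(−3)}(ℚ)`, Silverman *AEC*
  Exercise 10.16, tree `lift_rank_point_baseChange_quadratic`, and `E'^{(−3)} : y² = x³ − 27b²` is
  `3`-isogenous to `E'_b`, Vélu, tree `IsVeluThreePair.isIsogenous`);
* `natCard_range_cubicDescentClass_eq`: hence **`#δ(E'(K)) = 3^{rank_ℤ E'_b(ℚ) + 1}`** — the exact
  count by which the `√−3`-descent bounds the ranks of the cubic twists `y² = x³ + (2^a 5^b)²`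
  (`Literature/Barriers/BirchSwinnertonDyer/RankNotSumOfLocalInvariantsCubicTwists.lean`): upper
  bounds from local conditions confining `δ(E'(K))`, lower bounds from independent classes.

## References

* J. H. Silverman, *The Arithmetic of Elliptic Curves*, 2nd ed., GTM 106 (2009): X.4 (descent via
  an isogeny, Remark X.4.7), Exercise 10.16, Thm. VIII.6.7. [SilvermanAEC2009]
-/

noncomputable section

open scoped Classical


namespace Literature.NumberTheory.EllipticCurves

namespace SqrtThree

open WeierstrassCurve MordellDescent

universe v

section Count

/-- **Counting the values of a multiplicative map**: if `δ : A → M` is multiplicative on an abelian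
group with `{δ = 1} = R`, then `#δ(A) = [A : R]` (`A/R ≅ δ(A)`). [folklore] -/
theorem natCard_range_eq_index {A : Type*} {M : Type*} [AddCommGroup A] [CommGroup M] (δ : A → M)
    (hmul : ∀ P Q, δ (P + Q) = δ P * δ Q) (R : AddSubgroup A) (hR : ∀ P, δ P = 1 ↔ P ∈ R) :
    Nat.card (Set.range δ) = R.index := by
  let g : A →+ Additive M := AddMonoidHom.mk' (fun a ↦ Additive.ofMul (δ a)) fun P Q ↦ by
    rw [hmul]; rfl
  have hker : g.ker = R := by
    ext P
    rw [AddMonoidHom.mem_ker, ← hR]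
    exact ⟨fun h ↦ Additive.ofMul.injective h, fun h ↦ by
      change Additive.ofMul (δ P) = Additive.ofMul 1
      rw [h]⟩
  rw [← hker, AddSubgroup.index_ker]
  rfl

variable {K : Type v} [Field K] [NumberField K] {θ c : K}

/-- `E'(K)` is elliptic for `c ≠ 0`. [folklore] -/
theorem isElliptic_nine (hc : c ≠ 0) : (mordellCurve ((9 * c) ^ 2)).IsElliptic :=
  isElliptic_mordellCurve (pow_ne_zero 2 (nine_mul_ne_zero hc))

/-- **`#δ(E'(K)) = [E'(K) : f(E'(K))] = 3^{rank_ℤ E'(K)/2 + 1}` and `rank_ℤ E'(K)` is even**, for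
`E' : Y² = X³ + (9c)²` over a number field `K ∋ θ = √−3` (Mordell–Weil, tree
`WeierstrassCurve.module_finite_point_holds`; the index count `index_range_of_comp_self_of_card_ker`
for `f = [√−3]`, `f ∘ f = −3`, `#ker f = 3`; and `{δ = 1} = f(E'(K))`).
[cite: SilvermanAEC2009, X.4 Remark X.4.7] -/
theorem natCard_range_cubicDescentClass (hc : c ≠ 0) (hθ : θ ^ 2 = -3)
    (σ : AlgebraicClosure K ≃+* AlgebraicClosure K)
    (hσθ : σ (algebraMap K _ θ) = -algebraMap K _ θ) (hσc : σ (algebraMap K _ c) = algebraMap K _ c) :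
    Even (mordellCurve ((9 * c) ^ 2)).mordellWeilRank ∧
    Nat.card (Set.range (cubicDescentClass (mordellCurve ((9 * c) ^ 2)) (9 * c))) =
      3 ^ ((mordellCurve ((9 * c) ^ 2)).mordellWeilRank / 2 + 1) := by
  haveI := isElliptic_nine hc
  haveI : Module.Finite ℤ (mordellCurve ((9 * c) ^ 2)).toAffine.Point :=
    (mordellCurve ((9 * c) ^ 2)).module_finite_point_holds
  set f := sqrtThreeHom (nine_mul_ne_zero hc) hθ with hf
  have hB : σ (algebraMap K _ (9 * c)) = algebraMap K _ (9 * c) := by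
    rw [map_mul, map_mul, hσc, map_ofNat, map_ofNat]
  obtain ⟨heven, hidx⟩ := index_range_of_comp_self_of_card_ker f Nat.prime_three
    (sqrtThreeHom_comp_self _ hθ σ hσθ hB) (natCard_ker_sqrtThreeHom _ hθ σ hσθ hB)
  refine ⟨heven, ?_⟩
  rw [natCard_range_eq_index _ (cubicDescentClass_add rfl two_ne_zero (nine_mul_ne_zero hc)) f.range
    (cubicDescentClass_eq_one_iff_mem_range hc hθ σ hσθ hσc), hidx]
  rfl

end Count

/-! ## `rank_ℤ E'(K) = 2 rank_ℤ E'(ℚ)` for `K = ℚ(√−3)` and the final count -/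

section Rank

variable {K : Type} [Field K] [NumberField K] {θ c : K}

/-- The quadratic twist of `E'_b : y² = x³ + b²` by `−3` is Vélu's quotient `y² = x³ − 27b²`.
[cite: SilvermanAEC2009, X.5 Prop. 5.4] -/
theorem quadraticTwist_mordellCurve_sq (b : ℚ) :
    (mordellCurve (b ^ 2)).quadraticTwist (-3) = mordellCurve (-27 * b ^ 2) := by
  ext
  · rfl
  · simp [quadraticTwist_a₂, mordellCurve, WeierstrassCurve.b₂]
  · rfl
  · simp [quadraticTwist_a₄, mordellCurve, WeierstrassCurve.b₄]
  · simp [quadraticTwist_a₆, mordellCurve, WeierstrassCurve.b₆]; ring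

/-- `rank_ℤ E'^{(−3)}(ℚ) = rank_ℤ E'(ℚ)`: the twist by `−3` is `3`-isogenous to `E'` over `ℚ`
(Vélu; tree `IsVeluThreePair.isIsogenous`, `IsIsogenous.mordellWeilRank_eq`). [folklore] -/
theorem mordellWeilRank_quadraticTwist_neg_three {b : ℚ} (hb : b ≠ 0) :
    ((mordellCurve (b ^ 2)).quadraticTwist (-3)).mordellWeilRank = (mordellCurve (b ^ 2)).mordellWeilRank := by
  haveI := isElliptic_mordellCurve (pow_ne_zero 2 hb)
  haveI : (mordellCurve (-27 * b ^ 2) : WeierstrassCurve ℚ).IsElliptic :=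
    isElliptic_mordellCurve (mul_ne_zero (by norm_num) (pow_ne_zero 2 hb))
  rw [quadraticTwist_mordellCurve_sq]
  exact ((isVeluThreePair_sq hb).isIsogenous).mordellWeilRank_eq.symm

variable [Algebra ℚ K]

/-- `θ = √−3` is irrational. [folklore] -/
theorem theta_not_mem_range (hθ : θ ^ 2 = -3) : θ ∉ Set.range (algebraMap ℚ K) := by
  rintro ⟨q, hq⟩
  have h : (algebraMap ℚ K) (q ^ 2) = algebraMap ℚ K (-3) := by rw [map_pow, hq, hθ, map_neg, map_ofNat]
  have hq2 : q ^ 2 = -3 := (algebraMap ℚ K).injective h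
  nlinarith [sq_nonneg q]

/-- **`rank_ℤ E'(K) = 2 · rank_ℤ E'(ℚ)`** for `E' : y² = x³ + b²` (`b ∈ ℚ^×`) and a quadratic
number field `K ∋ θ = √−3`: `rank E'(K) = rank E'(ℚ) + rank E'^{(−3)}(ℚ)` (Silverman AEC
Exercise 10.16, tree `lift_rank_point_baseChange_quadratic`) and `rank E'^{(−3)}(ℚ) = rank E'(ℚ)`
(`3`-isogeny). The `K`-curve is written `Y² = X³ + (9c)²` with `9c = b`.
[cite: SilvermanAEC2009, Exercise 10.16] -/
theorem mordellWeilRank_eq_two_mul (h2 : Module.finrank ℚ K = 2) (hθ : θ ^ 2 = -3) {b : ℚ} (hb : b ≠ 0)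
    (hbc : algebraMap ℚ K b = 9 * c) :
    (mordellCurve ((9 * c) ^ 2)).mordellWeilRank = 2 * (mordellCurve (b ^ 2)).mordellWeilRank := by
  have hc : c ≠ 0 := by
    rintro rfl
    rw [mul_zero, map_eq_zero_iff _ (algebraMap ℚ K).injective] at hbc
    exact hb hbc
  haveI := isElliptic_mordellCurve (pow_ne_zero 2 hb)
  haveI := isElliptic_nine hc
  haveI hEt : ((mordellCurve (b ^ 2)).quadraticTwist (-3) : WeierstrassCurve ℚ).IsElliptic := by
    rw [quadraticTwist_mordellCurve_sq]
    exact isElliptic_mordellCurve (mul_ne_zero (by norm_num) (pow_ne_zero 2 hb))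
  -- the three groups are finitely generated (Mordell–Weil)
  haveI : Module.Finite ℤ (mordellCurve ((9 * c) ^ 2)).toAffine.Point :=
    (mordellCurve ((9 * c) ^ 2)).module_finite_point_holds
  -- for the two curves over `ℚ` the carrier's instances must be those baked into `mordellWeilRank`
  -- (generic `open scoped Classical` decidability), so the types are left to unification
  haveI : @Module.Finite ℤ (mordellCurve (b ^ 2) : WeierstrassCurve ℚ).toAffine.Point _
      (@AddCommGroup.toAddCommMonoid _ (@Affine.Point.instAddCommGroup ℚ _
        (mordellCurve (b ^ 2) : WeierstrassCurve ℚ).toAffine (fun x y => Classical.propDecidable (x = y))))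
      (@AddCommGroup.toIntModule _ (@Affine.Point.instAddCommGroup ℚ _
        (mordellCurve (b ^ 2) : WeierstrassCurve ℚ).toAffine (fun x y => Classical.propDecidable (x = y)))) :=
    (mordellCurve (b ^ 2) : WeierstrassCurve ℚ).module_finite_point_holds
  haveI : @Module.Finite ℤ ((mordellCurve (b ^ 2)).quadraticTwist (-3) : WeierstrassCurve ℚ).toAffine.Point _
      (@AddCommGroup.toAddCommMonoid _ (@Affine.Point.instAddCommGroup ℚ _
        ((mordellCurve (b ^ 2)).quadraticTwist (-3) : WeierstrassCurve ℚ).toAffine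
        (fun x y => Classical.propDecidable (x = y))))
      (@AddCommGroup.toIntModule _ (@Affine.Point.instAddCommGroup ℚ _
        ((mordellCurve (b ^ 2)).quadraticTwist (-3) : WeierstrassCurve ℚ).toAffine
        (fun x y => Classical.propDecidable (x = y)))) :=
    ((mordellCurve (b ^ 2)).quadraticTwist (-3) : WeierstrassCurve ℚ).module_finite_point_holds
  -- `E'_b ⊗ K = (Y² = X³ + (9c)²)`
  have hcurve : (mordellCurve (b ^ 2) : WeierstrassCurve ℚ).baseChange K = mordellCurve ((9 * c) ^ 2) := by
    rw [mordellCurve_baseChange, map_pow, hbc]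
  have e := Affine.Point.congrEquiv hcurve
  have hK : Module.rank ℤ (mordellCurve ((9 * c) ^ 2)).toAffine.Point =
      Module.rank ℤ ((mordellCurve (b ^ 2) : WeierstrassCurve ℚ).baseChange K).toAffine.Point :=
    e.symm.toIntLinearEquiv.rank_eq
  have hquad := lift_rank_point_baseChange_quadratic (mordellCurve (b ^ 2) : WeierstrassCurve ℚ)
    (K := K) h2 (theta_not_mem_range hθ) (c := -3) (by rw [hθ, map_neg, map_ofNat])
  -- all ranks are finite: pass to `finrank` (as cardinals)
  have htw := mordellWeilRank_quadraticTwist_neg_three hb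
  unfold WeierstrassCurve.mordellWeilRank at htw ⊢
  apply Nat.cast_injective (R := Cardinal)
  rw [Nat.cast_mul, Nat.cast_ofNat, two_mul]
  nth_rewrite 2 [← htw]
  rw [Module.finrank_eq_rank, hK, Module.finrank_eq_rank, Module.finrank_eq_rank]
  simpa only [Cardinal.lift_id, Cardinal.lift_uzero] using hquad

/-- **`#δ(E'(K)) = 3^{rank E'(ℚ) + 1}`**: for `E' : y² = x³ + b²` (`b ∈ ℚ^×`), a quadratic number
field `K ∋ θ = √−3` with an automorphism `σ` of `K̄` reversing `θ`, and the `φ`-descent map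
`δ : E'(K) → K^×/K^{×3}`, `(X, Y) ↦ Y + b` (written with `b = 9c`), the number of descent classes
is `3^{rank_ℤ E'(ℚ) + 1}` — the exact count behind the `√−3`-descent bounds
`3^{r+1} ≤ #(local conditions)` and `3^{m+1} ≤ 3^{r+1}` (from `m` independent classes) used for the
cubic twists `y² = x³ + (2^a 5^b)²`. [cite: SilvermanAEC2009, X.4 Remark X.4.7] -/
theorem natCard_range_cubicDescentClass_eq (h2 : Module.finrank ℚ K = 2) (hθ : θ ^ 2 = -3)
    (σ : AlgebraicClosure K ≃+* AlgebraicClosure K)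
    (hσθ : σ (algebraMap K _ θ) = -algebraMap K _ θ) (hσc : σ (algebraMap K _ c) = algebraMap K _ c)
    {b : ℚ} (hb : b ≠ 0) (hbc : algebraMap ℚ K b = 9 * c) :
    Nat.card (Set.range (cubicDescentClass (mordellCurve ((9 * c) ^ 2)) (9 * c))) =
      3 ^ ((mordellCurve (b ^ 2)).mordellWeilRank + 1) := by
  have hc : c ≠ 0 := by
    rintro rfl
    rw [mul_zero, map_eq_zero_iff _ (algebraMap ℚ K).injective] at hbc
    exact hb hbc
  obtain ⟨-, hcount⟩ := natCard_range_cubicDescentClass hc hθ σ hσθ hσc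
  rw [hcount, mordellWeilRank_eq_two_mul h2 hθ hb hbc, Nat.mul_div_cancel_left _ two_pos]

end Rank

end SqrtThree

end Literature.NumberTheory.EllipticCurves

end
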